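import Summits.QuantumFields.YangMills.Theorems.VirialFluxGapDeficitForm
import Summits.QuantumFields.YangMills.Theorems.VirialFluxGapLogSectorWeightConvex
import Summits.QuantumFields.YangMills.Theorems.VirialFluxGapConvexTransport
import Summits.QuantumFields.YangMills.Theorems.SwapVirialDeficitLaplaceAbelianLog
import HarnessLib

/-!
# The PERIODIC (zero-flux) femto ring at fixed `L`: mean action and ∀ε-softness of the seam sector `W₀` from the principal small-ball law
# in LOG-LIMIT FORM — the consumer the periodic massive-mode rung should aim at
# (free-hands support of ⟨stmt-QuantumFields-24196⟩ `SwapVirialDeficit.ToronSoftnessSharp`; periodic counterpart of fcl-p3 g45's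
# ✓`SwapRing.tendsto_meanAction_of_principalLimit` for the σ-glued ring; memo-24197-massive-mode-rung §3(v) «log-shell … analogous plan»)

The zero-flux seam sector weight of the periodic femto ring is `W₀(b) = e^{12bL⁴}·∫ e^{−bF₀} dμ_L` (✓`RingDeficit.log_sectorWeight_eq`,
`F₀ = ringDeficit L 0 ≥ 0` the periodic ring deficit on `(ring histories, μ_L = ringMeasure L)`).  Its state density near the toron valley carries
ONE LOGARITHM (zero-mode block = four pairwise nearly commuting letters, ✓`ZeroModeGroup.tendsto_haar_nearlyCommuting_div_log`; fixed-`L` two-sided rows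
✓`PeriodicRingFloor.log_volume_floor` ∕ ✓`PeriodicRingCeiling.log_volume_ceiling`: `μ_L{F₀ ≤ u} ≍ u^{9L⁴−3/2}·log u⁻¹`).  The SHARP law in the
currency the cell's blow-up proofs deliver — a LIMIT —

  `hlim : Tendsto (fun s => μ_L{F₀ ≤ s} / (s^{9L⁴−3/2} · log s⁻¹)) (𝓝[>] 0) (𝓝 v)`, `0 < v`

(the target of a periodic massive-mode rung: joint blow-up of the followers at scale `√u` and of the four leaders by fcl-p3 g44's two-scale K4 chain,
with a log-shell in place of ✓`BlowUp.smallBall_limit_real_of_blowUp_of_weight`) gives, at that `L`, with NO rate: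
* §1 `tendsto_loglog_window` — `log log(c·b) − log log b → 0` (`c > 0`): the iterated logarithm is FLAT on Laplace windows `[b/2, 2b]`;
* §2 ★ `tendsto_rpow_mul_laplace_div_log` — `b^α·∫e^{−bF₀}dμ_L / log b → v·Γ(α+1)`, `α = 9L⁴ − 3/2` (w2 g56's ✓`Abelian.tendsto_laplace_abelian_log`);
  ★★ `tendsto_logSectorWeight_sub` — `log W₀(b) − (12bL⁴ − α·log b + log log b) → log(v·Γ(α+1))`;
* §3 ★★★ `tendsto_periodicMeanAction_of_principalLogLimit` — `b·(log W₀)′(b) − 12bL⁴ → −(9L⁴ − 3/2)`: Griffiths' convex transport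
  ✓`ConvexTransport.window_bound` (convexity ✓`convexOn_log_sectorWeight_one`, smoothness ✓`hasDerivAt_sectorWeight_ringExponent`) run with the
  `b`-DEPENDENT model constant `C_b = C + log log b` — legitimate because of §1 — and `η → 0`;
* §4 ★★ `periodicSoftness_fixedL_of_principalLogLimit` — for every `ε > 0`, eventually
  `12bL⁴ − 9L⁴ + 3/2 − ε ≤ b·(log W₀)′(b) ≤ 12bL⁴ − 9L⁴ + 3/2 + ε`: the FIXED-`L` instance of the ∀ε sharp periodic softness `PeriodicSoftnessEps`
  (the zero-flux input of ✓`SectorMixture.toronSoftnessSharp_of_toronTubeVolumeLaw`; the crux ⟨24196⟩ itself is WINDOW-UNIFORM in `L`).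
Deliberately NOT here: the log-limit itself (periodic massive-mode rung: log-shell, periodic leader chart for functions, dominator with two small
parameters — all OPEN), the passage `W₀ ↦ Z_phys` through the sector mixture at fixed `L`.
HONEST LABEL: fixed-`L` real-analysis bookkeeping on landed rows; the periodic principal log-limit is NOT proved; ⟨24196⟩ ∕ ⟨24197⟩ ∕ ⟨24194⟩ ∕ ⟨24497⟩
(window-uniform) stay OPEN; own crux ⟨22884⟩ OPEN (blocked-on ⟨19935⟩); the Yang–Mills mass gap is NOT proved; no summit is proved by a line.
Width seat ym-line-sfw-p2-w3 g64 (cell ym-idea-1, free hands), `--supports stmt-QuantumFields-24196`.  THEOREMS ONLY (0 `def`, 0 `sorry`), standard axioms.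
References: [cite: Griffiths1964]; [cite: MontvayMunster1994, (3.145)]; [cite: Luscher1983, §2]; [cite: GonzalezarroyoAltes1988]; [folklore] (Feller XIII.5).
-/

set_option autoImplicit false

noncomputable section

open MeasureTheory Set Filter Topology
open scoped BigOperators ENNReal
open Literature.MathematicalPhysics.QuantumFieldTheory hiding SU2
open Literature.MathematicalPhysics.QuantumLattice

namespace Summit.QuantumFields.YangMills.Theorems.SwapVirialDeficit.PeriodicRing

open Summit.QuantumFields.YangMills.Theorems.FemtoTransferGap
open Summit.QuantumFields.YangMills.Theorems.FemtoTransferGap.TT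
open Summit.QuantumFields.YangMills.Theorems.FemtoTransferGap.TT.SectorSmooth (convexOn_log_sectorWeight_one sectorWeight_one_pos)
open Summit.QuantumFields.YangMills.Theorems.VirialFluxGap.RingDeficit
open Summit.QuantumFields.YangMills.Theorems.VirialFluxGap.ConvexTransport (window_bound)
open Summit.QuantumFields.YangMills.Theorems.SwapVirialDeficit.Abelian (tendsto_laplace_abelian_log)

variable {L : ℕ} [NeZero L]

/-! ## §1 The iterated logarithm is flat on Laplace windows -/

/-- `log log (c·b) − log log b → 0` as `b → ∞` (`c > 0`): `= log(1 + log c / log b)`. [folklore] -/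
theorem tendsto_loglog_window {c : ℝ} (hc : 0 < c) :
    Tendsto (fun b : ℝ => Real.log (Real.log (c * b)) - Real.log (Real.log b)) atTop (𝓝 0) := by
  have h1 : Tendsto (fun b : ℝ => Real.log c / Real.log b) atTop (𝓝 0) := tendsto_const_nhds.div_atTop Real.tendsto_log_atTop
  have h2 : Tendsto (fun b : ℝ => Real.log (1 + Real.log c / Real.log b)) atTop (𝓝 (Real.log (1 + 0))) :=
    (Real.continuousAt_log (by norm_num)).tendsto.comp (tendsto_const_nhds.add h1)
  rw [add_zero, Real.log_one] at h2
  refine h2.congr' ?_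
  have hcb : ∀ᶠ b : ℝ in atTop, 1 < c * b := (tendsto_id.const_mul_atTop hc).eventually_gt_atTop 1
  filter_upwards [eventually_gt_atTop (1 : ℝ), hcb] with b hb hcb1
  have hb0 : 0 < b := by linarith
  have hlogb : 0 < Real.log b := Real.log_pos hb
  have hlogcb : 0 < Real.log (c * b) := Real.log_pos hcb1
  have e : 1 + Real.log c / Real.log b = Real.log (c * b) / Real.log b := by
    rw [Real.log_mul hc.ne' hb0.ne']; field_simp; ring
  show Real.log (1 + Real.log c / Real.log b) = Real.log (Real.log (c * b)) - Real.log (Real.log b)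
  rw [e, Real.log_div hlogcb.ne' hlogb.ne']

/-- On the window `[b/2, 2b]` the iterated logarithm stays within `δ` of `log log b`, eventually in `b` (`δ > 0`). [folklore] -/
theorem eventually_loglog_window_le {δ : ℝ} (hδ : 0 < δ) :
    ∀ᶠ b : ℝ in atTop, ∀ x ∈ Icc (b / 2) (2 * b), |Real.log (Real.log x) - Real.log (Real.log b)| ≤ δ := by
  have hlo := (Metric.tendsto_nhds.1 (tendsto_loglog_window (c := 1 / 2) (by norm_num))) δ hδ
  have hhi := (Metric.tendsto_nhds.1 (tendsto_loglog_window (c := 2) (by norm_num))) δ hδ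
  filter_upwards [hlo, hhi, eventually_gt_atTop (2 : ℝ)] with b hlo' hhi' hb2
  intro x hx
  simp only [dist_zero_right, Real.norm_eq_abs] at hlo' hhi'
  have hx1 : 1 < x := by linarith [hx.1]
  have hbx : 1 < b / 2 := by linarith
  -- `log ∘ log` is monotone on `(1, ∞)`
  have hmono : ∀ {y y' : ℝ}, 1 < y → y ≤ y' → Real.log (Real.log y) ≤ Real.log (Real.log y') := fun hy hyy' =>
    Real.log_le_log (Real.log_pos hy) (Real.log_le_log (by linarith) hyy')
  have h1 : Real.log (Real.log (1 / 2 * b)) ≤ Real.log (Real.log x) := hmono (by linarith) (by linarith [hx.1])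
  have h2 : Real.log (Real.log x) ≤ Real.log (Real.log (2 * b)) := hmono hx1 hx.2
  rw [abs_le]
  constructor
  · linarith [(abs_lt.1 hlo').1]
  · linarith [(abs_lt.1 hhi').2]

/-! ## §2 The Laplace integral and `log W₀` from the log-limit -/

/-- ★ **From the principal log-limit**: `b^α·∫e^{−bF₀}dμ_L / log b → v·Γ(α+1)` (`α = 9L⁴ − 3/2`; ✓`Abelian.tendsto_laplace_abelian_log` on the probability
space `(ring histories, μ_L)`). [folklore] -/
theorem tendsto_rpow_mul_laplace_div_log {v : ℝ}
    (hlim : Tendsto (fun s : ℝ => (ringMeasure L).real {P | ringDeficit L (fun _ => false) P ≤ s} / (s ^ (9 * (L : ℝ) ^ 4 - 3 / 2) * Real.log s⁻¹))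
      (𝓝[>] 0) (𝓝 v)) :
    Tendsto (fun b : ℝ => b ^ (9 * (L : ℝ) ^ 4 - 3 / 2) * (∫ P, Real.exp (-(b * ringDeficit L (fun _ => false) P)) ∂(ringMeasure L)) / Real.log b)
      atTop (𝓝 (v * Real.Gamma (9 * (L : ℝ) ^ 4 - 3 / 2 + 1))) := by
  haveI := isProbabilityMeasure_ringMeasure (L := L)
  have hL1 : (1 : ℝ) ≤ L := by exact_mod_cast NeZero.one_le
  have hα : (0 : ℝ) < 9 * (L : ℝ) ^ 4 - 3 / 2 := by have := one_le_pow₀ (M₀ := ℝ) hL1 (n := 4); linarith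
  have hlim' : Tendsto (fun s : ℝ => ((ringMeasure L) {P | ringDeficit L (fun _ => false) P ≤ s}).toReal /
      (s ^ (9 * (L : ℝ) ^ 4 - 3 / 2) * Real.log s⁻¹)) (𝓝[>] 0) (𝓝 v) := by
    refine hlim.congr' (Eventually.of_forall fun s => ?_)
    simp only [measureReal_def]
  exact tendsto_laplace_abelian_log (ringMeasure L) (measurable_ringDeficit _) (ringDeficit_nonneg (L := L) _) hα hlim'

/-- ★★ **`log W₀(b) − (12bL⁴ − α·log b + log log b) → log(v·Γ(α+1))`** (`α = 9L⁴ − 3/2`) from the principal log-limit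
(✓`RingDeficit.log_sectorWeight_eq`: `log W₀ = 12bL⁴ + log ∫e^{−bF₀}dμ_L`). [cite: MontvayMunster1994, (3.145)] -/
theorem tendsto_logSectorWeight_sub {v : ℝ} (hv : 0 < v)
    (hlim : Tendsto (fun s : ℝ => (ringMeasure L).real {P | ringDeficit L (fun _ => false) P ≤ s} / (s ^ (9 * (L : ℝ) ^ 4 - 3 / 2) * Real.log s⁻¹))
      (𝓝[>] 0) (𝓝 v)) :
    Tendsto (fun b : ℝ => Real.log (TT.sectorWeight (L := L) b (2 * L - 1) (fun _ => false) (fun _ _ => (1 : ℝ))) -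
        (12 * b * (L : ℝ) ^ 4 - (9 * (L : ℝ) ^ 4 - 3 / 2) * Real.log b + Real.log (Real.log b)))
      atTop (𝓝 (Real.log (v * Real.Gamma (9 * (L : ℝ) ^ 4 - 3 / 2 + 1)))) := by
  have hL1 : (1 : ℝ) ≤ L := by exact_mod_cast NeZero.one_le
  have hα : (0 : ℝ) < 9 * (L : ℝ) ^ 4 - 3 / 2 := by have := one_le_pow₀ (M₀ := ℝ) hL1 (n := 4); linarith
  have hℓ : 0 < v * Real.Gamma (9 * (L : ℝ) ^ 4 - 3 / 2 + 1) := mul_pos hv (Real.Gamma_pos_of_pos (by linarith))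
  have hQ := tendsto_rpow_mul_laplace_div_log (L := L) hlim
  have hlog := hQ.log hℓ.ne'
  refine hlog.congr' ?_
  filter_upwards [eventually_gt_atTop (1 : ℝ), hQ.eventually (Ioi_mem_nhds hℓ)] with b hb1 hQpos
  have hb0 : 0 < b := by linarith
  have hlogb : 0 < Real.log b := Real.log_pos hb1
  have hI : 0 < ∫ P, Real.exp (-(b * ringDeficit L (fun _ => false) P)) ∂(ringMeasure L) := integral_exp_neg_mul_ringDeficit_pos b _
  have hbα : 0 < b ^ (9 * (L : ℝ) ^ 4 - 3 / 2) := Real.rpow_pos_of_pos hb0 _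
  rw [Real.log_div (mul_pos hbα hI).ne' hlogb.ne', Real.log_mul hbα.ne' hI.ne', Real.log_rpow hb0, log_sectorWeight_eq]
  ring

/-! ## §3 The mean action from the log-limit (Griffiths' convex transport, `η → 0`, `b`-dependent model constant) -/

/-- ★★★ **`⟨β𝒜⟩_{W₀} → 9L⁴ − 3/2` AT FIXED `L`, FROM THE PRINCIPAL LOG-LIMIT.**  If `μ_L{F₀ ≤ s}/(s^{9L⁴−3/2}·log s⁻¹) → v > 0` as `s → 0⁺`, then
`b·(d/db) log W₀(b) − 12bL⁴ → −(9L⁴ − 3/2)` as `b → ∞`: the reduced function `f(x) = log W₀(x) − 12L⁴x` is convex (✓`convexOn_log_sectorWeight_one`),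
differentiable (✓`hasDerivAt_sectorWeight_ringExponent`) and within `η` of `C_b − α·log x`, `C_b = log(vΓ(α+1)) + log log b`, on `[b/2, 2b]` for all
large `b` (§1–§2), for EVERY `η > 0`; ✓`ConvexTransport.window_bound` gives `|b·f′(b) + α| ≤ α·u + 4η/u` for any `u ∈ (0,1]`.  The logarithm of
the state density moves the MODEL CONSTANT, not the slope. [cite: Griffiths1964] [cite: MontvayMunster1994, (3.145)] [cite: Luscher1983, §2] -/
theorem tendsto_periodicMeanAction_of_principalLogLimit (L : ℕ) [NeZero L] {v : ℝ} (hv : 0 < v)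
    (hlim : Tendsto (fun s : ℝ => (ringMeasure L).real {P | ringDeficit L (fun _ => false) P ≤ s} / (s ^ (9 * (L : ℝ) ^ 4 - 3 / 2) * Real.log s⁻¹))
      (𝓝[>] 0) (𝓝 v)) :
    Tendsto (fun b : ℝ => b * deriv (fun x : ℝ => Real.log (TT.sectorWeight (L := L) x (2 * L - 1) (fun _ => false) (fun _ _ => (1 : ℝ)))) b -
        12 * b * (L : ℝ) ^ 4) atTop (𝓝 (-(9 * (L : ℝ) ^ 4 - 3 / 2))) := by
  have hL1 : (1 : ℝ) ≤ L := by exact_mod_cast NeZero.one_le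
  set N : ℝ := 9 * (L : ℝ) ^ 4 - 3 / 2 with hN
  set D : ℝ := 2 * N with hD
  have hN7 : 7 ≤ N := by
    have : (1 : ℝ) ≤ (L : ℝ) ^ 4 := one_le_pow₀ hL1
    rw [hN]; linarith
  have hD0 : 0 < D := by rw [hD]; linarith
  set C : ℝ := Real.log (v * Real.Gamma (9 * (L : ℝ) ^ 4 - 3 / 2 + 1)) with hC
  set W : ℝ → ℝ := fun x => TT.sectorWeight (L := L) x (2 * L - 1) (fun _ => false) (fun _ _ => (1 : ℝ)) with hW
  have hWpos : ∀ x : ℝ, 0 < W x := fun x => sectorWeight_one_pos (L := L) x (2 * L - 1) _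
  -- the reduced function `f = log W₀ − 12L⁴·x`
  set f : ℝ → ℝ := fun x => Real.log (W x) - 12 * (L : ℝ) ^ 4 * x with hf
  have hmodel : Tendsto (fun x : ℝ => f x + D / 2 * Real.log x - Real.log (Real.log x) - C) atTop (𝓝 0) := by
    have h := (tendsto_logSectorWeight_sub (L := L) hv hlim).sub_const C
    rw [sub_self] at h
    refine h.congr fun x => ?_
    simp only [hf, hW, hD, hN, hC]; ring
  rw [Metric.tendsto_atTop]
  intro ε hε
  -- choose `u ∈ (0,1]` with `D·u/2 ≤ ε/4`, then `η > 0` with `4η/u = ε/4`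
  set u : ℝ := min 1 (ε / (2 * D)) with hu
  have hu0 : 0 < u := lt_min one_pos (by positivity)
  have hu1 : u ≤ 1 := min_le_left _ _
  have huD : D * u / 2 ≤ ε / 4 := by
    have h1 : u ≤ ε / (2 * D) := min_le_right _ _
    have h2 : D * u ≤ D * (ε / (2 * D)) := mul_le_mul_of_nonneg_left h1 hD0.le
    have h3 : D * (ε / (2 * D)) = ε / 2 := by field_simp
    rw [h3] at h2
    linarith
  set η : ℝ := ε * u / 16 with hη
  have hη0 : 0 < η := by positivity
  have hηu : 4 * η / u = ε / 4 := by rw [hη]; field_simp; ring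
  -- the model holds within `η/2` beyond `x₀`, and `log log` is `η/2`-flat on windows beyond `b₁`
  have hev : ∀ᶠ x : ℝ in atTop, |f x + D / 2 * Real.log x - Real.log (Real.log x) - C| < η / 2 := by
    have h := (Metric.tendsto_nhds.1 hmodel) (η / 2) (by positivity)
    simpa only [dist_zero_right, Real.norm_eq_abs] using h
  obtain ⟨x₀, hx₀⟩ := hev.exists_forall_of_atTop
  obtain ⟨b₁, hb₁⟩ := (eventually_loglog_window_le (δ := η / 2) (by positivity)).exists_forall_of_atTop
  refine ⟨max (max (2 * x₀) 2) b₁, fun b hb => ?_⟩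
  have hb2 : 2 ≤ b := le_trans (le_trans (le_max_right _ _) (le_max_left _ _)) hb
  have hb0 : 0 < b := by linarith
  have hbx : 2 * x₀ ≤ b := le_trans (le_trans (le_max_left _ _) (le_max_left _ _)) hb
  have hbb₁ : b₁ ≤ b := le_trans (le_max_right _ _) hb
  -- convexity and differentiability of `f`
  -- an affine function is concave (cf. ✓`SwapRing.concaveOn_const_mul`, inlined to keep the import closure small)
  have hlin : ConcaveOn ℝ (Set.Icc (b / 2) (2 * b)) (fun x : ℝ => 12 * (L : ℝ) ^ 4 * x) := by
    have h := (concaveOn_id (convex_Icc (b / 2) (2 * b))).smul (show (0 : ℝ) ≤ 12 * (L : ℝ) ^ 4 by positivity)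
    simpa only [smul_eq_mul, id] using h
  have hconv : ConvexOn ℝ (Set.Icc (b / 2) (2 * b)) f :=
    ((convexOn_log_sectorWeight_one (L := L) (2 * L - 1) (fun _ => false)).subset (Set.subset_univ _) (convex_Icc _ _)).sub hlin
  have hdlog : DifferentiableAt ℝ (fun x : ℝ => Real.log (W x)) b :=
    ((hasDerivAt_sectorWeight_ringExponent (L := L) b (fun _ => false)).differentiableAt).log (hWpos b).ne'
  have hdlin : HasDerivAt (fun x : ℝ => 12 * (L : ℝ) ^ 4 * x) (12 * (L : ℝ) ^ 4) b := by
    simpa using (hasDerivAt_id b).const_mul (12 * (L : ℝ) ^ 4)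
  have hfd : HasDerivAt f (deriv (fun x : ℝ => Real.log (W x)) b - 12 * (L : ℝ) ^ 4) b := hdlog.hasDerivAt.sub hdlin
  have hdiff : DifferentiableAt ℝ f b := hfd.differentiableAt
  have hderiv : deriv f b = deriv (fun x : ℝ => Real.log (W x)) b - 12 * (L : ℝ) ^ 4 := hfd.deriv
  -- the model on the window `[b/2, 2b]` with the constant `C_b = C + log log b`
  have happrox : ∀ x ∈ Set.Icc (b / 2) (2 * b), |f x + D / 2 * Real.log x - (C + Real.log (Real.log b))| ≤ η := by
    intro x hx
    have hx1 : x₀ ≤ x := by linarith [hx.1]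
    have h1 := (hx₀ x hx1).le
    have h2 := hb₁ b hbb₁ x hx
    have e : f x + D / 2 * Real.log x - (C + Real.log (Real.log b)) =
        (f x + D / 2 * Real.log x - Real.log (Real.log x) - C) + (Real.log (Real.log x) - Real.log (Real.log b)) := by ring
    rw [e]
    calc |f x + D / 2 * Real.log x - Real.log (Real.log x) - C + (Real.log (Real.log x) - Real.log (Real.log b))|
        ≤ |f x + D / 2 * Real.log x - Real.log (Real.log x) - C| + |Real.log (Real.log x) - Real.log (Real.log b)| := abs_add_le _ _
      _ ≤ η / 2 + η / 2 := add_le_add h1 h2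
      _ = η := by ring
  -- convex transport
  have hT := window_bound f D (C + Real.log (Real.log b)) η b hb0 hD0.le hη0.le hconv hdiff happrox u hu0 hu1
  rw [hderiv, hηu] at hT
  rw [Real.dist_eq]
  have hdev : b * deriv (fun x : ℝ => Real.log (W x)) b - 12 * b * (L : ℝ) ^ 4 - -(9 * (L : ℝ) ^ 4 - 3 / 2) =
      b * (deriv (fun x : ℝ => Real.log (W x)) b - 12 * (L : ℝ) ^ 4) + D / 2 := by
    rw [hD, hN]; ring
  rw [hdev]
  calc |b * (deriv (fun x : ℝ => Real.log (W x)) b - 12 * (L : ℝ) ^ 4) + D / 2| ≤ D * u / 2 + ε / 4 := hT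
    _ ≤ ε / 4 + ε / 4 := by linarith
    _ < ε := by linarith

/-! ## §4 The fixed-`L` ∀ε sharp periodic softness of `W₀` -/

/-- ★★ **THE FIXED-`L` ∀ε SHARP PERIODIC SOFTNESS (and stiffness) OF THE ZERO-FLUX SEAM SECTOR, from the principal log-limit**: for every
`ε > 0` there is `β₀` with `12bL⁴ − 9L⁴ + 3/2 − ε ≤ b·(log W₀)′(b) ≤ 12bL⁴ − 9L⁴ + 3/2 + ε` for all `b ≥ β₀` — the fixed-`L` instance of
`PeriodicSoftnessEps` (whose content, like ⟨24196⟩'s, is window-uniformity in `L`): the zero-flux ring realises the FULL toron softness `3/2`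
at every fixed `L` the day the periodic principal log-limit lands. [cite: Griffiths1964] [cite: Luscher1983, §2] [cite: GonzalezarroyoAltes1988] -/
theorem periodicSoftness_fixedL_of_principalLogLimit (L : ℕ) [NeZero L] {v : ℝ} (hv : 0 < v)
    (hlim : Tendsto (fun s : ℝ => (ringMeasure L).real {P | ringDeficit L (fun _ => false) P ≤ s} / (s ^ (9 * (L : ℝ) ^ 4 - 3 / 2) * Real.log s⁻¹))
      (𝓝[>] 0) (𝓝 v))
    {ε : ℝ} (hε : 0 < ε) :
    ∃ β₀ : ℝ, ∀ b : ℝ, β₀ ≤ b →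
      12 * b * (L : ℝ) ^ 4 - 9 * (L : ℝ) ^ 4 + 3 / 2 - ε ≤
          b * deriv (fun x : ℝ => Real.log (TT.sectorWeight (L := L) x (2 * L - 1) (fun _ => false) (fun _ _ => (1 : ℝ)))) b ∧
      b * deriv (fun x : ℝ => Real.log (TT.sectorWeight (L := L) x (2 * L - 1) (fun _ => false) (fun _ _ => (1 : ℝ)))) b ≤
          12 * b * (L : ℝ) ^ 4 - 9 * (L : ℝ) ^ 4 + 3 / 2 + ε := by
  obtain ⟨β₀, hβ₀⟩ := (Metric.tendsto_atTop.1 (tendsto_periodicMeanAction_of_principalLogLimit L hv hlim)) ε hε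
  refine ⟨β₀, fun b hb => ?_⟩
  have hd := hβ₀ b hb
  rw [Real.dist_eq] at hd
  have h2 := abs_lt.1 hd
  constructor <;> linarith [h2.1, h2.2]

/-- ★ **Gibbs-mean form** (✓`deficitFormZero`'s virial identity): from the principal log-limit, the Gibbs mean of the periodic deficit obeys
`b·⟨F₀⟩_b → 9L⁴ − 3/2` as `b → ∞` — equipartition with `18L⁴ − 3` transverse Gaussian directions, `4` toron moduli minus one stabiliser and the
quartic commutator valley (the log only moves the constant). [cite: Luscher1983, §2] [cite: GonzalezarroyoAltes1988] -/
theorem tendsto_gibbsMean_of_principalLogLimit (L : ℕ) [NeZero L] {v : ℝ} (hv : 0 < v)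
    (hlim : Tendsto (fun s : ℝ => (ringMeasure L).real {P | ringDeficit L (fun _ => false) P ≤ s} / (s ^ (9 * (L : ℝ) ^ 4 - 3 / 2) * Real.log s⁻¹))
      (𝓝[>] 0) (𝓝 v)) :
    Tendsto (fun b : ℝ => b * (∫ P, ringDeficit L (fun _ => false) P * Real.exp (-(b * ringDeficit L (fun _ => false) P)) ∂(ringMeasure L)) /
        (∫ P, Real.exp (-(b * ringDeficit L (fun _ => false) P)) ∂(ringMeasure L))) atTop (𝓝 (9 * (L : ℝ) ^ 4 - 3 / 2)) := by
  obtain ⟨-, -, hvir⟩ := deficitFormZero L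
  have h := (tendsto_periodicMeanAction_of_principalLogLimit L hv hlim).neg
  rw [neg_neg] at h
  refine h.congr' ?_
  filter_upwards [eventually_gt_atTop (0 : ℝ)] with b hb
  rw [hvir b hb]
  ring

end Summit.QuantumFields.YangMills.Theorems.SwapVirialDeficit.PeriodicRing

end
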